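import Summits.HodgeConjecture.HodgeConjecture.Theorems.RigidRelativesJacobianTorelliRelativesTateAlgebraicLeftInverse
import Summits.HodgeConjecture.HodgeConjecture.Theorems.RigidRelativesJacobianTorelliCMCorrespondenceTateAlgebraicComp
import Literature.NumberTheory.EllipticCurves.KugaSatoVariety
import HarnessLib

/-!
# Crux `CMCorrespondenceTate` (stmt-HodgeConjecture-18580), line `birth` — stub 3 `stub_algebraicLeftInverse`, and the
# skeleton's composition RUN WITH STUBS 3 AND 4 DISCHARGED: the crux from the anchor (stub 1) and the CM twist (stub 2)

Route `HodgeConjecture/RigidRelativesJacobianTorelli`, crux `CMCorrespondenceTate` (rank 4; Tate for `X × X`, CM face).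
Registered skeleton `Cruxes/CMCorrespondenceTate/Lines/birth.lean`: `CMCorrespondenceTate_of : S₁ → S₂ → S₃ → S₄ → the crux`
(anchor → CM twist → algebraic left inverse → composition). Stub 4 is landed verbatim
(`Theorems.CMCorrespondenceTate.stub_algebraicComp`); stub 3 is the case `n = 3`, `X = X₀ ⊗_ℚ ℂ` of the theorem
`Theorems.RelativesTate.exists_algebraicLeftInverse_of_finrank_eq_two` (file `…RelativesTateAlgebraicLeftInverse`:
conjugate transpose, Hodge–Riemann on `H^{3,0} ⊕ H^{0,3}`, Cayley–Hamilton) — the rationality clause of `IsAnchor` is not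
even needed. This file records

* `stub_algebraicLeftInverse` — the registered signature of stub 3 VERBATIM, in the skeleton's spelling through file-local
  notations for its carriers `cx`, `Rigid`, `IsAnchor` (display only; nothing is defined);
* `cmCorrespondenceTate_of_kugaSatoAnchor_of_kugaSatoCMTwist : S₁ → S₂ → Theses.RigidRelativesJacobianTorelli.CMCorrespondenceTate`
  — the skeleton's composition with stubs 3 and 4 plugged in: hypotheses = the statements of the two OPEN stubs
  (`stub_kugaSatoAnchor`: every rigid-type threefold over `ℚ` is anchored in a weight-4 Kuga–Sato threefold — the geometric
  realisation problem; `stub_kugaSatoCMTwist`: Galois-detected CM is realised on the hub by an algebraic self-correspondence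
  `R` with `R ∘ A = A ∘ T`, `T` non-scalar — twisting operators are motivic, CM case), VERBATIM in the skeleton's spelling;
  conclusion = the route's crux decl BY NAME. `Θ := L ∘ (R ∘ A)` is algebraic (composition, twice) and equals
  `L ∘ A ∘ T = T`, non-scalar.

So the crux `CMCorrespondenceTate` IS, in the kernel, "anchor + CM twist" on the Kuga–Sato hub.

HONEST STATUS. Nothing here is a case of the Hodge or Tate conjectures: the main theorem is an implication whose hypotheses
are the crux's two open stubs. No definition (the carriers are file-local notations), no named fact, no sorry.
References: [Scholl1990] Thm. 1.2.4, §4; Brown–Ghate 2003 (Thm. 2.3.8); Ribet 1980 (Thm. 5.1);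
[Kleiman1968AlgebraicCycles] §3 Prop. 3.5, Appendix to §2; [Fulton1998] §16.1 Prop. 16.1.1; [VoisinHodgeI2002] §6.3.2 Thm. 6.32.
-/

noncomputable section

-- every declaration of this problem lives in `Summit.HodgeConjecture.HodgeConjecture.…` (summit = sub-problem)
set_option linter.dupNamespace false

open CategoryTheory AlgebraicGeometry
open Literature.AlgebraicGeometry.Motives Literature.AlgebraicGeometry.HodgeTheory
open Literature.NumberTheory.EllipticCurves (KugaSatoVariety)

namespace Summit.HodgeConjecture.HodgeConjecture.Theorems.CMCorrespondenceTate

/-! ## The skeleton's carriers, as file-local notations (display only) -/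

/-- `cx Y₀ = Y₀ ⊗_ℚ ℂ` — the crux's `let cx`. -/
local notation3 "cx " Y₀:max => (baseChange ℚ ℂ).obj Y₀

/-- `Rigid Y₀` — the crux's `let Rigid`: smooth projective threefold over `ℚ`, `dim H³((Y₀)_ℂ; ℂ) = 2`, a non-zero
`(3,0)`-class. -/
local notation3 "Rigid " Y₀:max => (IsSmoothProjective 3 Y₀ ∧ Module.finrank ℂ (complexBetti (cx Y₀) 3) = 2 ∧
    ∃ x : complexBetti (cx Y₀) 3, x ≠ 0 ∧ IsOfHodgeType 3 (cx Y₀) 3 3 0 x)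

/-- `GalCM Y₀` — the crux's `let GalCM`: the rational `ℓ`-adic `H³` carries a non-scalar endomorphism commuting with an
open subgroup of `Gal(ℚ̄/ℚ)`. -/
local notation3 "GalCM " Y₀:max => (∃ (ℓ : ℕ) (_ : Fact ℓ.Prime) (U : OpenSubgroup (Field.absoluteGaloisGroup ℚ))
    (T : ellAdicEtaleCohomologyRat ℓ 3 (geometricFibre ℚ Y₀) →ₗ[ℚ_[ℓ]] ellAdicEtaleCohomologyRat ℓ 3 (geometricFibre ℚ Y₀)),
    (∀ g ∈ U, T ∘ₗ geometricEllAdicEtaleCohomologyRepRat ℓ Y₀ 3 g = geometricEllAdicEtaleCohomologyRepRat ℓ Y₀ 3 g ∘ₗ T) ∧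
      ∀ c : ℚ_[ℓ], T ≠ c • LinearMap.id)

/-- `IsAnchor X₀ W A` — the skeleton's anchor predicate: `A` is induced by an algebraic correspondence on `W × (X₀)_ℂ`,
injective, and carries rational classes to rational classes. -/
local notation3 "IsAnchor " X₀:max W:max A:max => (IsAlgebraicCorrespondence 3 3 W (cx X₀) A ∧ Function.Injective A ∧
    ∀ x : complexBetti (cx X₀) 3, IsRationalClass x → IsRationalClass (A x))

/-! ## The carriers are the crux's (`Iff.rfl`) -/

/-- **The crux is literally the statement over these carriers** (`Iff.rfl`). [folklore] -/
theorem cmCorrespondenceTate_iff :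
    Summit.HodgeConjecture.HodgeConjecture.Theses.RigidRelativesJacobianTorelli.CMCorrespondenceTate ↔
      ∀ ⦃X₀ : SchemeOver.{0} ℚ⦄, Rigid X₀ → GalCM X₀ →
        ∃ Θ : complexBetti (cx X₀) 3 →ₗ[ℂ] complexBetti (cx X₀) 3,
          IsAlgebraicCorrespondence 3 3 (cx X₀) (cx X₀) Θ ∧ ∀ c : ℂ, Θ ≠ c • LinearMap.id :=
  Iff.rfl

/-! ## Stub 3 in the registered spelling -/

/-- **Stub `stub_algebraicLeftInverse` of crux `CMCorrespondenceTate` (registered signature, verbatim in the skeleton's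
spelling): an anchor of a rigid-type threefold in a smooth projective complex threefold has an algebraic left inverse.**
The rationality clause of `IsAnchor` is not used: `Theorems.RelativesTate.exists_algebraicLeftInverse_of_finrank_eq_two`
handles complex combinations of cycle classes through the conjugate transpose.
[cite: Kleiman1968AlgebraicCycles, Appendix to §2 (Thm. 2A11) and §3 Prop. 3.5] [cite: VoisinHodgeI2002, §6.3.2 Thm. 6.32]
[cite: Lieberman1968, Thm. 1] -/
theorem stub_algebraicLeftInverse :
    ∀ X₀ : SchemeOver.{0} ℚ, Rigid X₀ →
      ∀ (W : SchemeOver.{0} ℂ), IsSmoothProjective 3 W →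
        ∀ (A : complexBetti (cx X₀) 3 →ₗ[ℂ] complexBetti W 3), IsAnchor X₀ W A →
          ∃ L : complexBetti W 3 →ₗ[ℂ] complexBetti (cx X₀) 3,
            IsAlgebraicCorrespondence 3 3 (cx X₀) W L ∧ L ∘ₗ A = LinearMap.id :=
  fun _ hR _ hW _ hA ↦
    RelativesTate.exists_algebraicLeftInverse_of_finrank_eq_two (IsSmoothProjective.baseChange_holds (k := ℚ) ℂ hR.1) hW
      (by norm_num) hR.2.1 hR.2.2 hA.1 hA.2.1

/-! ## The composition, with stubs 3 and 4 discharged -/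

/-- **`CMCorrespondenceTate` from the anchor and the CM twist alone** (the skeleton's `CMCorrespondenceTate_of` with
`stub_algebraicLeftInverse` and `stub_algebraicComp` plugged in): for `X₀` of rigid type with Galois-detected CM, anchor it
in a weight-4 Kuga–Sato threefold `W` (hypothesis 1), realise the CM on the hub by an algebraic `R` with `R ∘ A = A ∘ T`,
`T` non-scalar (hypothesis 2), left-invert the anchor algebraically (THEOREM), and compose (THEOREM):
`Θ := L ∘ (R ∘ A) = T` is a non-scalar algebraic self-correspondence of `H³((X₀)_ℂ)`.
[cite: Scholl1990, Thm. 1.2.4 and §4] [cite: Kleiman1968AlgebraicCycles, §3]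
[cite: Fulton1998, §16.1 Prop. 16.1.1] -/
theorem cmCorrespondenceTate_of_kugaSatoAnchor_of_kugaSatoCMTwist
    (hAnchor : ∀ X₀ : SchemeOver.{0} ℚ, Rigid X₀ →
      ∃ (N : ℕ) (V : KugaSatoVariety ℂ 2 N)
        (A : complexBetti (cx X₀) 3 →ₗ[ℂ] complexBetti V.W 3), IsAnchor X₀ V.W A)
    (hTwist : ∀ X₀ : SchemeOver.{0} ℚ, Rigid X₀ → GalCM X₀ →
      ∀ (N : ℕ) (V : KugaSatoVariety ℂ 2 N)
        (A : complexBetti (cx X₀) 3 →ₗ[ℂ] complexBetti V.W 3), IsAnchor X₀ V.W A →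
          ∃ (R : complexBetti V.W 3 →ₗ[ℂ] complexBetti V.W 3)
            (T : complexBetti (cx X₀) 3 →ₗ[ℂ] complexBetti (cx X₀) 3),
            IsAlgebraicCorrespondence 3 3 V.W V.W R ∧ R ∘ₗ A = A ∘ₗ T ∧
              ∀ c : ℂ, T ≠ c • LinearMap.id) :
    Summit.HodgeConjecture.HodgeConjecture.Theses.RigidRelativesJacobianTorelli.CMCorrespondenceTate := by
  refine cmCorrespondenceTate_iff.2 fun X₀ hX hG ↦ ?_
  obtain ⟨N, V, A, hAV⟩ := hAnchor X₀ hX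
  obtain ⟨R, T, hR, hRA, hTns⟩ := hTwist X₀ hX hG N V A hAV
  have hW : IsSmoothProjective 3 V.W := V.smoothProjective
  -- algebraic left inverse of the anchor (THEOREM, stub 3)
  obtain ⟨L, hLalg, hLA⟩ := stub_algebraicLeftInverse X₀ hX V.W hW A hAV
  have hX' : IsSmoothProjective 3 (cx X₀) := IsSmoothProjective.baseChange_holds (k := ℚ) ℂ hX.1
  refine ⟨L ∘ₗ (R ∘ₗ A), ?_, ?_⟩
  · -- composition (THEOREM, stub 4), twice
    exact stub_algebraicComp 3 3 (cx X₀) V.W (cx X₀) hX' hW hX' (R ∘ₗ A) L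
      (stub_algebraicComp 3 3 (cx X₀) V.W V.W hX' hW hW A R hAV.1 hR) hLalg
  · have hΘ : L ∘ₗ (R ∘ₗ A) = T := by
      rw [hRA, ← LinearMap.comp_assoc, hLA, LinearMap.id_comp]
    intro c
    rw [hΘ]
    exact hTns c

end Summit.HodgeConjecture.HodgeConjecture.Theorems.CMCorrespondenceTate

end
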